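import Mathlib
import Literature.AlgebraicGeometry.Resolution.PolygonMinimality
import Literature.AlgebraicGeometry.Resolution.AxialUnitChainLaw
import Literature.AlgebraicGeometry.Resolution.VPreparedInitialLabel
import Literature.AlgebraicGeometry.Resolution.FormalAxisOfNearChain
import HarnessLib

/-!
# A prepared adapted coordinate lies on every permissible centre inside `div(u₁)`

Topic: `Literature/AlgebraicGeometry/Resolution`. V. Cossart, U. Jannsen, S. Saito, LNM 2270 (2020),
proof of Thm. 13.7 / Claim 13.8 («Σ ⊆ V(y, u₁)» for a well-prepared `y`), Lemma 11.5, Thm. 8.24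
[cite: CossartJannsenSaito2020, Claim 13.8]; H. Hironaka, J. Math. Kyoto Univ. 7 (1967), Thm. (4.8)
(minimality of the prepared polygon) [cite: Hironaka1967, Thm. (4.8)]; V. Cossart, O. Piltant, J. Algebra
320 (2008), (16) and proof of Prop. 4.4 p. 11 [cite: CossartPiltant2008, Prop. 4.4].

OURS (brick B5c of the `τ = 1` endgame, architecture (B)). Let `c = (y, u₁, u₂)` be a regular system
of parameters of a three-dimensional regular local ring, `J ⊆ 𝔪^μ` of order exactly `μ` (`0 < μ`)
and adapted (`L < δs`), and `P = (y₁, u₁)` a «permissible centre through the point inside `div(u₁)`»: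
`(y₁, u₁, u₂) = 𝔪` and `J ⊆ P^μ`. (1) If `c` has a monic element and is prepared at every vertex
(`PreparedUpTo` for all bounds) then `J ⊆ (y, u₁)^μ` (`le_span_pair_pow_of_forall_preparedUpTo`):
`P = (y + t, u₁)` with `t ∈ (u₁, u₂)`, the polygon of `(y + t, u)` lies in `{x₁ ≥ 1}` (CJS Lemma 12.4 (1)
form `le_add_of_isInitialTerm_of_mem_span_pair_pow`), hence so does the MINIMAL polygon of the prepared
`(y, u)` (Hironaka (4.8), `PolygonMinimality`), i.e. `J ⊆ F^{(LN, LN, L)}_{LNμ} ⊆ (y, u₁)^μ + 𝔪^N` for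
all `N`, and ideals are closed (Krull). (2) If `J ⊆ (y, u₁)^μ` as well, then `y ∈ P`, i.e. `P = (y, u₁)`
(`mem_span_pair_of_le_span_pair_pow`): otherwise `y₁ ∉ (y, u₁)` and `J ⊆ (y₁^μ) + (u₁)` with the
`y₁^μ`-coefficients in the prime `(y, u₁)`, so `J ⊆ 𝔪^{μ+1} + (u₁)`, contradicting adaptedness
(`not_le_pow_succ_sup_span_of_lt_deltaS`). F-71 / T1 / N2 NOT proved; no summit statement is proved.
-/

noncomputable section

open IsLocalRing MvPolynomial

namespace Literature.AlgebraicGeometry.Resolution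

universe u

section Centre

variable {S : Type u} [CommRing S] [IsRegularLocalRing S] (c : Fin 3 → S)
  (hgen : Ideal.span {c 0, c 1, c 2} = maximalIdeal S) (hdim : ringKrullDim S = 3)
  {J : Ideal S} {μ : ℕ}

include hdim in
/-- `𝔪` needs exactly three generators. [folklore] -/
private theorem spanFinrank_eq_three : (maximalIdeal S).spanFinrank = 3 := by
  have h := IsRegularLocalRing.spanFinrank_maximalIdeal (R := S)
  rw [hdim] at h
  exact_mod_cast h

include hgen hdim in
/-- `(y, u₁)` is a prime different from `𝔪`. [cite: Matsumura1987, Thm. 17.8] -/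
private theorem span_pair01_isPrime_and_ne :
    (Ideal.span ({c 0, c 1} : Set S)).IsPrime ∧ Ideal.span ({c 0, c 1} : Set S) ≠ maximalIdeal S := by
  have hfr := spanFinrank_eq_three hdim
  have hxr := span_range_eq_of_span_triple c hgen
  refine ⟨?_, fun h => ?_⟩
  · have := isPrime_span_image hfr c hxr {0, 1}
    rwa [Finset.coe_insert, Finset.coe_singleton, Set.image_insert_eq, Set.image_singleton] at this
  · have hfin : ({c 0, c 1} : Set S).Finite := Set.toFinite _
    have hle : (Ideal.span ({c 0, c 1} : Set S)).spanFinrank ≤ ({c 0, c 1} : Set S).ncard :=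
      Submodule.spanFinrank_span_le_ncard_of_finite hfin
    have hcard : ({c 0, c 1} : Set S).ncard ≤ 2 := by
      refine (Set.ncard_insert_le _ _).trans ?_
      rw [Set.ncard_singleton]
    have h3 : (Ideal.span ({c 0, c 1} : Set S)).spanFinrank = 3 := by rw [h]; exact hfr
    omega

include hgen hdim in
/-- `u₂ ∉ (y, u₁)`. [folklore] -/
private theorem c2_not_mem_span_pair01 : c 2 ∉ Ideal.span ({c 0, c 1} : Set S) := by
  intro h2
  apply (span_pair01_isPrime_and_ne c hgen hdim).2
  apply le_antisymm
  · rw [← hgen]; apply Ideal.span_mono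
    intro x hx; rcases hx with rfl | rfl <;> simp
  · rw [← hgen, Ideal.span_le]
    rintro x (rfl | rfl | rfl)
    · exact Ideal.subset_span (by simp)
    · exact Ideal.subset_span (by simp)
    · exact h2

omit [IsRegularLocalRing S] in
/-- Membership in a triple span: `x = r a + s b + t d`. [folklore] -/
private theorem exists_of_mem_span_triple {a b d x : S} (hx : x ∈ Ideal.span ({a, b, d} : Set S)) :
    ∃ r s t : S, x = r * a + s * b + t * d := by
  rw [Ideal.span_insert] at hx
  obtain ⟨ra, hra, z, hz, rfl⟩ := Submodule.mem_sup.mp hx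
  obtain ⟨r, rfl⟩ := Ideal.mem_span_singleton'.mp hra
  obtain ⟨s, t, hst⟩ := Ideal.mem_span_pair.mp hz
  exact ⟨r, s, t, by rw [← hst]; ring⟩

include hgen hdim in
/-- If `y₁ ∈ (y, u₁)` and `(y₁, u₁, u₂) = 𝔪` then `y ∈ (y₁, u₁)`. [folklore] -/
private theorem c0_mem_span_pair_of_mem {y₁ : S} (hgen₁ : Ideal.span {y₁, c 1, c 2} = maximalIdeal S)
    (hy₁ : y₁ ∈ Ideal.span ({c 0, c 1} : Set S)) : c 0 ∈ Ideal.span ({y₁, c 1} : Set S) := by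
  have hP := (span_pair01_isPrime_and_ne c hgen hdim).1
  have hc0 : c 0 ∈ Ideal.span ({y₁, c 1, c 2} : Set S) := by
    rw [hgen₁, ← hgen]; exact Ideal.subset_span (by simp)
  obtain ⟨r, s, t, hrst⟩ := exists_of_mem_span_triple hc0
  -- `t u₂ ∈ (y, u₁)`, so `t ∈ (y, u₁)`
  have htc2 : t * c 2 ∈ Ideal.span ({c 0, c 1} : Set S) := by
    have : t * c 2 = c 0 - r * y₁ - s * c 1 := by rw [hrst]; ring
    rw [this]
    exact Ideal.sub_mem _ (Ideal.sub_mem _ (Ideal.subset_span (by simp)) (Ideal.mul_mem_left _ _ hy₁))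
      (Ideal.mul_mem_left _ _ (Ideal.subset_span (by simp)))
  have ht : t ∈ Ideal.span ({c 0, c 1} : Set S) :=
    (hP.mem_or_mem htc2).resolve_right (c2_not_mem_span_pair01 c hgen hdim)
  obtain ⟨t₀, t₁, ht⟩ := Ideal.mem_span_pair.mp ht
  -- `y (1 − t₀ u₂) = r y₁ + (s + t₁ u₂) u₁`
  have hunit : IsUnit (1 - t₀ * c 2) := by
    refine IsLocalRing.isUnit_one_sub_self_of_mem_nonunits _ ?_
    rw [← mem_maximalIdeal, ← hgen]
    exact Ideal.mul_mem_left _ _ (Ideal.subset_span (by simp))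
  have hkey : c 0 * (1 - t₀ * c 2) = r * y₁ + (s + t₁ * c 2) * c 1 := by
    have h := hrst
    rw [← ht] at h
    linear_combination h
  have hmem : c 0 * (1 - t₀ * c 2) ∈ Ideal.span ({y₁, c 1} : Set S) := by
    rw [hkey]
    exact Ideal.add_mem _ (Ideal.mul_mem_left _ _ (Ideal.subset_span (by simp)))
      (Ideal.mul_mem_left _ _ (Ideal.subset_span (by simp)))
  obtain ⟨v, hv⟩ := hunit
  have : c 0 = c 0 * (1 - t₀ * c 2) * ↑v⁻¹ := by rw [← hv, mul_assoc, Units.mul_inv, mul_one]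
  rw [this]
  exact Ideal.mul_mem_right _ _ hmem

omit [IsRegularLocalRing S] in
/-- `(a, b)^μ ⊆ (a^μ) + (b)`. [folklore] -/
private theorem span_pair_pow_le_sup (a b : S) (μ : ℕ) :
    Ideal.span ({a, b} : Set S) ^ μ ≤ Ideal.span {a ^ μ} ⊔ Ideal.span {b} := by
  induction μ with
  | zero => simp
  | succ k ih =>
    rw [pow_succ]
    refine (Ideal.mul_mono_left ih).trans ?_
    rw [Ideal.sup_mul, Ideal.span_insert, Ideal.mul_sup]
    refine sup_le (sup_le ?_ ?_) ?_
    · rw [Ideal.span_singleton_mul_span_singleton, ← pow_succ]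
      exact le_sup_left
    · exact (Ideal.mul_le_left).trans le_sup_right
    · exact (Ideal.mul_le_right).trans le_sup_right

include hgen hdim in
/-- **(2) Two permissible centres in `div(u₁)` through an adapted point coincide.** If `c = (y, u₁, u₂)`
is adapted to `J ⊆ 𝔪^μ` (`L < δs`, `J ⊄ 𝔪^{μ+1}`), `J ⊆ (y, u₁)^μ` and `J ⊆ (y₁, u₁)^μ` with
`(y₁, u₁, u₂) = 𝔪`, then `y ∈ (y₁, u₁)`. [cite: CossartJannsenSaito2020, Claim 13.8]
[cite: CossartPiltant2008, Prop. 4.4 (proof, p. 11)] -/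
theorem mem_span_pair_of_le_span_pair_pow (hJμ : J ≤ maximalIdeal S ^ μ)
    (hJne : ¬ J ≤ maximalIdeal S ^ (μ + 1)) (hδ : μ.factorial < deltaS c J μ)
    (hJc : J ≤ Ideal.span {c 0, c 1} ^ μ) (y₁ : S)
    (hgen₁ : Ideal.span {y₁, c 1, c 2} = maximalIdeal S) (hJP : J ≤ Ideal.span {y₁, c 1} ^ μ) :
    c 0 ∈ Ideal.span ({y₁, c 1} : Set S) := by
  classical
  by_contra h0
  have hP := (span_pair01_isPrime_and_ne c hgen hdim).1
  -- `y₁ ∉ (y, u₁)`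
  have hy₁ : y₁ ∉ Ideal.span ({c 0, c 1} : Set S) := fun h =>
    h0 (c0_mem_span_pair_of_mem c hgen hdim hgen₁ h)
  -- `μ ≥ 1` (the polygon is non-empty since `δs > L`)
  have hμ : 0 < μ := by
    by_contra hμ0
    have hz : μ = 0 := by omega
    subst hz
    have hemp : pts c J 0 = ∅ := Set.eq_empty_of_forall_notMem fun e he => Nat.not_lt_zero _ he.2
    have : deltaS c J 0 = 0 := by rw [deltaS, hemp, Set.image_empty, Nat.sInf_empty]
    rw [this] at hδ
    exact Nat.not_lt_zero _ hδ
  -- every `f ∈ J` lies in `𝔪^{μ+1} + (u₁)`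
  apply not_le_pow_succ_sup_span_of_lt_deltaS c hgen hdim hJμ hJne hδ
  intro f hf
  obtain ⟨g₁, hg₁, g₂, hg₂, hsum⟩ := Submodule.mem_sup.mp (span_pair_pow_le_sup y₁ (c 1) μ (hJP hf))
  obtain ⟨r, rfl⟩ := Ideal.mem_span_singleton'.mp hg₁
  -- `r y₁^μ ∈ (y, u₁)`, hence `r ∈ (y, u₁) ⊆ 𝔪`
  have hP1 : Ideal.span ({c 0, c 1} : Set S) ^ μ ≤ Ideal.span {c 0, c 1} := Ideal.pow_le_self hμ.ne'
  have hry : r * y₁ ^ μ ∈ Ideal.span ({c 0, c 1} : Set S) := by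
    have : r * y₁ ^ μ = f - g₂ := by rw [← hsum]; ring
    rw [this]
    refine Ideal.sub_mem _ (hP1 (hJc hf)) ?_
    obtain ⟨s, rfl⟩ := Ideal.mem_span_singleton'.mp hg₂
    exact Ideal.mul_mem_left _ _ (Ideal.subset_span (by simp))
  have hr : r ∈ Ideal.span ({c 0, c 1} : Set S) := by
    rcases hP.mem_or_mem hry with h | h
    · exact h
    · exact absurd (hP.mem_of_pow_mem μ h) hy₁
  have hrm : r ∈ maximalIdeal S := by
    rw [← hgen]
    exact Ideal.span_mono (by intro x hx; rcases hx with rfl | rfl <;> simp) hr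
  have hy₁m : y₁ ∈ maximalIdeal S := hgen₁ ▸ Ideal.subset_span (by simp)
  rw [← hsum]
  refine Submodule.add_mem_sup ?_ hg₂
  rw [pow_succ']
  exact Ideal.mul_mem_mul hrm (Ideal.pow_mem_pow hy₁m μ)

include hgen hdim in
/-- A first member `y₁` of a regular system `(y₁, u₁, u₂)` is `α y + β u₁ + γ u₂` with `α` a unit
(Nakayama). [folklore] -/
private theorem exists_unit_repr {y₁ : S} (hgen₁ : Ideal.span {y₁, c 1, c 2} = maximalIdeal S) :
    ∃ α β γ : S, y₁ = α * c 0 + β * c 1 + γ * c 2 ∧ IsUnit α := by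
  have hy₁ : y₁ ∈ Ideal.span ({c 0, c 1, c 2} : Set S) := by
    rw [hgen, ← hgen₁]; exact Ideal.subset_span (by simp)
  obtain ⟨α, β, γ, h⟩ := exists_of_mem_span_triple hy₁
  refine ⟨α, β, γ, h, ?_⟩
  by_contra hα
  have hαm : α ∈ maximalIdeal S := (mem_maximalIdeal _).mpr hα
  -- then `𝔪 = (y₁, u₁, u₂) ⊆ (u₁, u₂) + 𝔪²`, so `𝔪 = (u₁, u₂)` by Nakayama
  have hc0m : c 0 ∈ maximalIdeal S := hgen ▸ Ideal.subset_span (by simp)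
  have hle' : (Ideal.span ({y₁, c 1, c 2} : Set S) : Submodule S S) ≤
      (Ideal.span ({c 1, c 2} : Set S) : Submodule S S) ⊔
        (maximalIdeal S : Ideal S) • (maximalIdeal S : Submodule S S) := by
    rw [Ideal.span_le, Set.insert_subset_iff, Set.insert_subset_iff, Set.singleton_subset_iff]
    refine ⟨?_, ?_, ?_⟩
    · rw [SetLike.mem_coe, h]
      refine Submodule.mem_sup.mpr ⟨β * c 1 + γ * c 2, ?_, α * c 0, ?_, by ring⟩
      · exact Ideal.add_mem _ (Ideal.mul_mem_left _ _ (Ideal.subset_span (by simp)))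
          (Ideal.mul_mem_left _ _ (Ideal.subset_span (by simp)))
      · rw [Ideal.smul_eq_mul]; exact Ideal.mul_mem_mul hαm hc0m
    · exact Submodule.mem_sup_left (Ideal.subset_span (by simp))
    · exact Submodule.mem_sup_left (Ideal.subset_span (by simp))
  have hle : (maximalIdeal S : Submodule S S) ≤
      (Ideal.span ({c 1, c 2} : Set S) : Submodule S S) ⊔
        (maximalIdeal S : Ideal S) • (maximalIdeal S : Submodule S S) :=
    calc (maximalIdeal S : Submodule S S) = Ideal.span ({y₁, c 1, c 2} : Set S) := hgen₁.symm
      _ ≤ _ := hle'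
  have hjac : (maximalIdeal S) ≤ (⊥ : Ideal S).jacobson := IsLocalRing.maximalIdeal_le_jacobson _
  have hfg : (maximalIdeal S : Submodule S S).FG := (maximalIdeal S).fg_of_isNoetherianRing
  have hm : (maximalIdeal S : Submodule S S) ≤ Ideal.span ({c 1, c 2} : Set S) :=
    Submodule.le_of_le_smul_of_le_jacobson_bot hfg hjac hle
  -- contradiction: `(u₁, u₂) = 𝔪` needs at most two generators
  have hfr := spanFinrank_eq_three hdim
  have heq : Ideal.span ({c 1, c 2} : Set S) = maximalIdeal S := by
    refine le_antisymm ?_ hm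
    rw [← hgen]; exact Ideal.span_mono (by intro x hx; rcases hx with rfl | rfl <;> simp)
  have hfin : ({c 1, c 2} : Set S).Finite := Set.toFinite _
  have hcard : (Ideal.span ({c 1, c 2} : Set S)).spanFinrank ≤ ({c 1, c 2} : Set S).ncard :=
    Submodule.spanFinrank_span_le_ncard_of_finite hfin
  have h2 : ({c 1, c 2} : Set S).ncard ≤ 2 := (Set.ncard_insert_le _ _).trans (by rw [Set.ncard_singleton])
  rw [heq, hfr] at hcard
  omega

omit [IsRegularLocalRing S] in
/-- `(y + t, u₁, u₂) = (y, u₁, u₂)` as ideals for `t ∈ (u₁, u₂)`. [folklore] -/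
private theorem span_triple_shiftZ_eq'' [IsLocalRing S] (hgen : Ideal.span {c 0, c 1, c 2} = maximalIdeal S)
    {t : S} (ht : t ∈ Ideal.span ({c 1, c 2} : Set S)) :
    Ideal.span {shiftZ c t 0, shiftZ c t 1, shiftZ c t 2} = maximalIdeal S := by
  rw [← hgen]
  simp only [shiftZ_zero, shiftZ_one, shiftZ_two]
  have hsub : ∀ y₀ : S, t ∈ Ideal.span ({y₀, c 1, c 2} : Set S) := fun y₀ => by
    rw [Ideal.span_insert]; exact Submodule.mem_sup_right ht
  apply le_antisymm
  · rw [Ideal.span_le]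
    rintro x (rfl | rfl | rfl)
    · exact Ideal.add_mem _ (Ideal.subset_span (by simp)) (hsub _)
    · exact Ideal.subset_span (by simp)
    · exact Ideal.subset_span (by simp)
  · rw [Ideal.span_le]
    rintro x (rfl | rfl | rfl)
    · have h1 : c 0 + t ∈ Ideal.span ({c 0 + t, c 1, c 2} : Set S) := Ideal.subset_span (by simp)
      have h := Ideal.sub_mem _ h1 (hsub (c 0 + t))
      rwa [add_sub_cancel_right] at h
    · exact Ideal.subset_span (by simp)
    · exact Ideal.subset_span (by simp)

include hgen in
/-- **Krull step**: `F^{(LN, LN, L)}_{LNμ} ⊆ (y, u₁)^μ + 𝔪^N` — a monomial of that weight has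
`y u₁`-degree `≥ μ` or `u₂`-degree `≥ N`. [folklore] -/
private theorem weightedIdealW_levelWeight_le_span_pair_pow_sup (μ N : ℕ) :
    weightedIdealW c (levelWeight μ (μ.factorial * N) N 1) (μ.factorial * N * μ) ≤
      Ideal.span {c 0, c 1} ^ μ ⊔ maximalIdeal S ^ N := by
  have hc : ∀ i, c i ∈ maximalIdeal S := fun i => by
    rw [← hgen]; apply Ideal.subset_span; fin_cases i <;> simp
  have hL := Nat.factorial_pos μ
  apply Ideal.span_le.mpr
  rintro m ⟨e, he, rfl⟩
  by_cases h0 : μ ≤ e 0 + e 1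
  · apply Ideal.mem_sup_left
    simp only [monom3]
    refine Ideal.mul_mem_right _ _ (Ideal.pow_le_pow_right h0 ?_)
    rw [pow_add]
    exact Ideal.mul_mem_mul (Ideal.pow_mem_pow (Ideal.subset_span (by simp)) _)
      (Ideal.pow_mem_pow (Ideal.subset_span (by simp)) _)
  · apply Ideal.mem_sup_right
    rw [weight_levelWeight] at he
    have h1 : e 0 + e 1 + 1 ≤ μ := by omega
    have h2 : μ.factorial * (N * e 1 + 1 * e 2) = μ.factorial * N * e 1 + μ.factorial * e 2 := by ring
    have h3 : μ.factorial * N * (e 0 + e 1 + 1) =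
        μ.factorial * N * e 0 + μ.factorial * N * e 1 + μ.factorial * N := by ring
    have h4 : μ.factorial * N * (e 0 + e 1 + 1) ≤ μ.factorial * N * μ := Nat.mul_le_mul_left _ h1
    rw [h2] at he
    rw [h3] at h4
    have h5 : μ.factorial * N ≤ μ.factorial * e 2 := by omega
    have hNe : N ≤ e 2 := Nat.le_of_mul_le_mul_left h5 hL
    have hmem : monom3 c e ∈ maximalIdeal S ^ e 2 := by
      simp only [monom3]
      exact Ideal.mul_mem_left _ _ (Ideal.pow_mem_pow (hc 2) _)
    exact Ideal.pow_le_pow_right hNe hmem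

include hgen hdim in
/-- **(1) A prepared polygon lies in `{x₁ ≥ 1}` as soon as some `(y + t, u)` does** (minimality of the
prepared polygon, Hironaka (4.8)): if `c = (y, u₁, u₂)` has a monic element for `J ⊆ 𝔪^μ`, is prepared
at every vertex, and `J ⊆ (y₁, u₁)^μ` for some `y₁` with `(y₁, u₁, u₂) = 𝔪`, then `J ⊆ (y, u₁)^μ`.
[cite: Hironaka1967, Thm. (4.8)] [cite: CossartJannsenSaito2020, Lemma 11.5, Claim 13.8]
[cite: CossartPiltant2008, (16)] -/
theorem le_span_pair_pow_of_forall_preparedUpTo (hJμ : J ≤ maximalIdeal S ^ μ)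
    (hmon : HasMonic c J μ) (hprep : ∀ B, PreparedUpTo c J μ B) (y₁ : S)
    (hgen₁ : Ideal.span {y₁, c 1, c 2} = maximalIdeal S) (hJP : J ≤ Ideal.span {y₁, c 1} ^ μ) :
    J ≤ Ideal.span {c 0, c 1} ^ μ := by
  classical
  have hL := Nat.factorial_pos μ
  -- `(y₁, u₁) = (y + t, u₁)` with `t ∈ (u₂)`
  obtain ⟨α, β, γ, hy₁, hα⟩ := exists_unit_repr c hgen hdim hgen₁
  obtain ⟨αu, rfl⟩ := hα
  set t : S := ↑αu⁻¹ * γ * c 2 with ht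
  have htmem : t ∈ Ideal.span ({c 1, c 2} : Set S) :=
    Ideal.mul_mem_left _ _ (Ideal.subset_span (by simp))
  have hPeq : Ideal.span ({y₁, c 1} : Set S) = Ideal.span {c 0 + t, c 1} := by
    have h1 : y₁ = ↑αu * (c 0 + t) + β * c 1 := by
      have h2 : (↑αu : S) * (↑αu⁻¹ * γ * c 2) = γ * c 2 := by
        rw [← mul_assoc, ← mul_assoc, Units.mul_inv, one_mul]
      rw [hy₁, ht, mul_add, h2]; ring
    rw [h1, Ideal.span_pair_add_mul_right, Ideal.span_insert, Ideal.span_insert,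
      Ideal.span_singleton_mul_left_unit αu.isUnit]
  -- the competitor system `c′ = (y + t, u₁, u₂)`: its polygon lies in `{x₁ ≥ 1}`
  have hgen' := span_triple_shiftZ_eq'' c hgen htmem
  have hJP' : J ≤ Ideal.span {shiftZ c t 0, shiftZ c t 1} ^ μ := by
    rw [shiftZ_zero, shiftZ_one, ← hPeq]; exact hJP
  have hS' : ∀ N, 0 < N → ∀ e ∈ pts (shiftZ c t) J μ,
      μ.factorial * N ≤ N * spt₁ μ e + 1 * spt₂ μ e := by
    intro N hN e he
    obtain ⟨⟨f, hfJ, w, hw, hinit⟩, he0⟩ := he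
    have h := le_add_of_isInitialTerm_of_mem_span_pair_pow (shiftZ c t) hgen' hdim hw (hJP' hfJ) hinit
    have hspt : μ.factorial ≤ spt₁ μ e := by
      rw [spt₁, ← sub_mul_sfac he0]
      exact Nat.mul_le_mul_right _ (by omega)
    calc μ.factorial * N = N * μ.factorial := mul_comm _ _
      _ ≤ N * spt₁ μ e := Nat.mul_le_mul_left _ hspt
      _ ≤ N * spt₁ μ e + 1 * spt₂ μ e := Nat.le_add_right _ _
  -- minimality of the prepared polygon: the same half-planes hold for `c`
  have hS : ∀ N, 0 < N → ∀ e ∈ pts c J μ, μ.factorial * N ≤ N * spt₁ μ e + 1 * spt₂ μ e :=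
    fun N hN => forall_pts_of_forall_pts_shiftZ_of_forall_preparedUpTo c hgen hdim hJμ hmon hprep htmem
      hN Nat.one_pos (hS' N hN)
  -- hence `J ⊆ (y, u₁)^μ + 𝔪^N` for every `N`, and ideals are closed
  refine le_of_forall_le_sup_pow fun N => ?_
  rcases Nat.eq_zero_or_pos N with rfl | hN
  · simp
  have hw₀ : 0 < μ.factorial * N := Nat.mul_pos hL hN
  have h1 := (le_weightedIdealW_levelWeight_iff c hgen hdim J hw₀ hN Nat.one_pos).mpr (hS N hN)
  exact h1.trans (weightedIdealW_levelWeight_le_span_pair_pow_sup c hgen μ N)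

include hgen hdim in
/-- **B5c (OURS). A prepared adapted coordinate lies on every permissible centre inside `div(u₁)`.**
Let `c = (y, u₁, u₂)` be a regular system of parameters of a three-dimensional regular local ring,
`J ⊆ 𝔪^μ`, `J ⊄ 𝔪^{μ+1}`, adapted (`L < δs`) with a monic element, prepared at every vertex, and
`P = (y₁, u₁)` with `(y₁, u₁, u₂) = 𝔪` and `J ⊆ P^μ`. Then `J ⊆ (y, u₁)^μ` and `y ∈ P` (so
`P = (y, u₁)`): the prepared `y` vanishes on the centre. [cite: CossartJannsenSaito2020, Claim 13.8, Thm. 8.24]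
[cite: Hironaka1967, Thm. (4.8)] [cite: CossartPiltant2008, Prop. 4.4 (proof, p. 11)] -/
theorem le_span_pair_pow_and_mem_of_forall_preparedUpTo (hJμ : J ≤ maximalIdeal S ^ μ)
    (hJne : ¬ J ≤ maximalIdeal S ^ (μ + 1)) (hδ : μ.factorial < deltaS c J μ)
    (hmon : HasMonic c J μ) (hprep : ∀ B, PreparedUpTo c J μ B) (y₁ : S)
    (hgen₁ : Ideal.span {y₁, c 1, c 2} = maximalIdeal S) (hJP : J ≤ Ideal.span {y₁, c 1} ^ μ) :
    J ≤ Ideal.span {c 0, c 1} ^ μ ∧ c 0 ∈ Ideal.span ({y₁, c 1} : Set S) := by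
  have hJc := le_span_pair_pow_of_forall_preparedUpTo c hgen hdim hJμ hmon hprep y₁ hgen₁ hJP
  exact ⟨hJc, mem_span_pair_of_le_span_pair_pow c hgen hdim hJμ hJne hδ hJc y₁ hgen₁ hJP⟩

end Centre

end Literature.AlgebraicGeometry.Resolution

end
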